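import Summits.ValiantsHypothesis.ValiantsHypothesis.Theorems.KPlusLogSqLawTridiagonalRealStaticUnitRows
import Summits.ValiantsHypothesis.ValiantsHypothesis.Theorems.KPlusLogSqLawTridiagonalRealStaticUnitSmall
import Summits.ValiantsHypothesis.ValiantsHypothesis.Theorems.KPlusLogSqLawTridiagonalRealStaticUnitAutomatonDefs

/-!
# Route «KPlusLogSqLaw», crux `WeakLifting` (stmt-ValiantsHypothesis-19561) — REAL side of the tridiagonal sector:
# the UNIT-COEFFICIENT sub-sector, ALL SIZES — the PIVOT SIGN AUTOMATON: a sound decision procedure for EMPTY sign chambers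

HONEST FRAMING.  Helper theorems (`--supports stmt-ValiantsHypothesis-19561 --as helper`), seat val-sym-lift-p1 (g17), cell `pub-symmetroid`,
2026-08-28.  Currency `StaticTridiagonalRealPotential.pathDet (fun _ => 1) d (fun _ => 1) f m`; edge slopes `L_k = 2f_k − d_k − d_{k+1}`; at a point
`x > 0` the link of edge `k` is RECESSIVE if `x^{2f_k} < x^{d_k + d_{k+1}}` (`b_k = x^{L_k} < 1`: ascending slope on `(0,1)`, descending on `(1,∞)`)
and DOMINANT otherwise.  The continuants `D_k(x)` obey `D_{k+2} = x^{d_{k+1}} D_{k+1} − x^{2f_k} D_k`, i.e. the normalised pivots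
`π_{k+1} = D_{k+1}/(x^{d_k} D_k)` obey `π₁ = 1`, `π' = 1 − b/π`.  The six ABSTRACT PIVOT STATES `E (π = 1)`, `A (0 < π < 1)`, `J (π > 1)`,
`N (π < 0)`, `Z (D_{k+1} = 0)`, `P0 (D_k = 0)` evolve NON-DETERMINISTICALLY but soundly under one edge:
`E →rec A`, `E →dom N`, `N → J`, `A →rec {A, Z, N}`, `A →dom N`, `J →rec A`, `J →dom {A, Z, N}`, `Z → P0`, `P0 → E` (`step`).  Proved here:
* `step_sound` — every real pair `(D_k, D_{k+1})` realising a state moves to a pair realising one of the listed successor states (elementary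
  inequalities, no division), with the sign of the newest continuant tracked;
* `runN_sound` — hence along any design the actual pair realises some branch of the automaton run `runN`;
* **EMPTINESS CRITERION** (`eval_ne_zero_of_noZero`, `card_posRoots_unit_eq_zero_of_automaton`): if for the slope-sign word of a unit design the
  run on `(0,1)` (recessive = ascending) and the run on `(1,∞)` (recessive = descending) both end WITHOUT the state `Z` — a finite check,
  `noZero … = true` by `decide` for any concrete word — and `m % 3 ≠ 2`, the design has NO positive determinant zero; for `m % 3 = 2` the same
  check gives EXACTLY ONE zero, the resonance `x = 1` (`card_posRoots_unit_eq_one_of_automaton`).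
* Instances (`decide`): the empty sign classes of size `7` (`+ + − + + −`, `+ + − + − −`, `+ − − + + −`) and size `10` (`+ + − + + − + + −`,
  `+ + − + + − + − −`, `+ + − + − − + + −`, `+ − − + + − + + −`), the exactly-one classes of size `5` (`+ + − +`, `+ − − +`) and size `8`
  (`+ + − + + − +`, `+ + − + − − +`, `+ − + + − − +`, `+ − − + − − +`) — exactly the classes the located census finds (seat tools scanpat.c /
  automaton2.py: the criterion matches the census at every size `m ≤ 10`; the triple-block family of `…UnitTripleBlocks` is its `(+ − *)^k` instance).
Nothing here is an upper law for the register (α NO MOVER); nothing bears on `WeakLifting` / `TropicalB` (stmt-19771) in their windows, Conjecture B,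
the Door-A registers, `MatrixDescartes` (stmt-18050) or VP ≠ VNP.
[this seat; folklore: LDLᵀ pivots of a Jacobi matrix, Sturm-type sign bookkeeping]
-/

-- `Summit.ValiantsHypothesis.ValiantsHypothesis.…` repeats a component by the D-0017 layout (single-conjunct summit); the name is mandated.
set_option linter.dupNamespace false
set_option autoImplicit false

namespace Summit.ValiantsHypothesis.ValiantsHypothesis.Theorems.KPlusLogSqLaw
namespace StaticTridiagonalRealUnit

open Polynomial Finset
open Summit.ValiantsHypothesis.ValiantsHypothesis.Theorems.KPlusLogSqLaw.StaticTridiagonalRealPotential (pathDet)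

open PState

/-- in every state except `Z` the newest continuant is non-zero. -/
theorem ne_zero_of_realizes {x : ℝ} {e : ℕ} {P Q σ : ℝ} {s : PState} (h : Realizes x e P Q s σ) (hs : s ≠ Z) (hx : 0 < x) : Q ≠ 0 := by
  intro hQ
  cases s <;> simp only [Realizes, hQ, mul_zero] at h
  · have := pow_pos hx e; nlinarith [h.1, h.2]
  · exact lt_irrefl _ h.1
  · have := mul_pos (pow_pos hx e) h.1; linarith [h.2]
  · exact lt_irrefl _ h.1
  · exact hs rfl
  · exact lt_irrefl _ h.2

/-! ### Soundness of one step -/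

/-- **one edge is sound**: from a realised state the new pair `(Q, x^{d'}Q − x^{2f}P)` realises one of the successor states of `step`,
the sign being flipped exactly when the flag says so (`rec`: `x^{2f} < x^{e+d'}`, `dom`: the reverse strict inequality). [this file] -/
theorem step_sound {x : ℝ} (hx : 0 < x) {e d' f : ℕ} {P Q σ : ℝ} (hσ : σ = 1 ∨ σ = -1) {s : PState} (rec : Bool)
    (hreal : Realizes x e P Q s σ)
    (hb : if rec then x ^ (2 * f) < x ^ (e + d') else x ^ (e + d') < x ^ (2 * f)) :
    ∃ p ∈ step rec s, Realizes x d' Q (x ^ d' * Q - x ^ (2 * f) * P) p.1 (flipIf p.2 σ) := by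
  have hσ2 : σ * σ = 1 := by rcases hσ with h | h <;> simp [h]
  have pd := pow_pos hx d'
  have pf := pow_pos hx (2 * f)
  have pe := pow_pos hx e
  have ped : x ^ (e + d') = x ^ e * x ^ d' := pow_add _ _ _
  -- the new quantity in signed form
  have key : σ * (x ^ d' * Q - x ^ (2 * f) * P) = x ^ d' * (σ * Q) - x ^ (2 * f) * (σ * P) := by ring
  cases s with
  | E =>
    obtain ⟨hP, hQ⟩ := hreal
    have hQ' : σ * (x ^ d' * Q - x ^ (2 * f) * P) = (σ * P) * (x ^ (e + d') - x ^ (2 * f)) := by rw [key, hQ, ped]; ring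
    cases rec with
    | true =>
      simp only [ite_true] at hb
      refine ⟨(A, false), by simp [step], ?_⟩
      simp only [Realizes, flipIf]
      refine ⟨by rw [hQ']; nlinarith, ?_⟩
      rw [key]; nlinarith [mul_pos pf hP, mul_pos pe hP]
    | false =>
      simp only [Bool.false_eq_true, ↓reduceIte] at hb
      refine ⟨(N, true), by simp [step], ?_⟩
      simp only [Realizes, flipIf, neg_mul]
      refine ⟨by rw [hQ']; nlinarith, by rw [hQ]; nlinarith [mul_pos pe hP]⟩
  | N =>
    obtain ⟨hQ, hP⟩ := hreal
    refine ⟨(J, false), by simp [step], ?_⟩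
    simp only [Realizes, flipIf]
    refine ⟨hQ, ?_⟩
    rw [key]; nlinarith [mul_pos pf (neg_pos.2 hP)]
  | A =>
    obtain ⟨hQ, hQP⟩ := hreal
    have hP : 0 < σ * P := by nlinarith
    have hlt : σ * (x ^ d' * Q - x ^ (2 * f) * P) < x ^ d' * (σ * Q) := by rw [key]; nlinarith [mul_pos pf hP]
    cases rec with
    | true =>
      rcases lt_trichotomy (σ * (x ^ d' * Q - x ^ (2 * f) * P)) 0 with h | h | h
      · refine ⟨(N, true), by simp [step], ?_⟩
        simp only [Realizes, flipIf, neg_mul]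
        exact ⟨by linarith, by linarith⟩
      · refine ⟨(Z, false), by simp [step], ?_⟩
        simp only [Realizes, flipIf]
        refine ⟨?_, hQ⟩
        rcases hσ with h1 | h1 <;> simp [h1] at h ⊢ <;> linarith
      · refine ⟨(A, false), by simp [step], ?_⟩
        simp only [Realizes, flipIf]
        exact ⟨h, hlt⟩
    | false =>
      simp only [Bool.false_eq_true, ↓reduceIte] at hb
      refine ⟨(N, true), by simp [step], ?_⟩
      simp only [Realizes, flipIf, neg_mul]
      have : x ^ d' * (σ * Q) < x ^ d' * (x ^ e * (σ * P)) := mul_lt_mul_of_pos_left hQP pd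
      refine ⟨?_, by linarith⟩
      rw [key]; nlinarith [mul_pos pe hP]
  | J =>
    obtain ⟨hP, hPQ⟩ := hreal
    have hQ : 0 < σ * Q := by nlinarith [mul_pos pe hP]
    have hlt : σ * (x ^ d' * Q - x ^ (2 * f) * P) < x ^ d' * (σ * Q) := by rw [key]; nlinarith [mul_pos pf hP]
    cases rec with
    | true =>
      simp only [ite_true] at hb
      refine ⟨(A, false), by simp [step], ?_⟩
      simp only [Realizes, flipIf]
      refine ⟨?_, hlt⟩
      have : x ^ d' * (x ^ e * (σ * P)) < x ^ d' * (σ * Q) := mul_lt_mul_of_pos_left hPQ pd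
      rw [key]; nlinarith [mul_pos pe hP]
    | false =>
      rcases lt_trichotomy (σ * (x ^ d' * Q - x ^ (2 * f) * P)) 0 with h | h | h
      · refine ⟨(N, true), by simp [step], ?_⟩
        simp only [Realizes, flipIf, neg_mul]
        exact ⟨by linarith, by linarith⟩
      · refine ⟨(Z, false), by simp [step], ?_⟩
        simp only [Realizes, flipIf]
        refine ⟨?_, hQ⟩
        rcases hσ with h1 | h1 <;> simp [h1] at h ⊢ <;> linarith
      · refine ⟨(A, false), by simp [step], ?_⟩
        simp only [Realizes, flipIf]
        exact ⟨h, hlt⟩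
  | Z =>
    obtain ⟨hQ0, hP⟩ := hreal
    refine ⟨(P0, true), by simp [step], ?_⟩
    simp only [Realizes, flipIf, neg_mul]
    refine ⟨hQ0, ?_⟩
    rw [key, hQ0, mul_zero, mul_zero, zero_sub]; nlinarith [mul_pos pf hP]
  | P0 =>
    obtain ⟨hP0, hQ⟩ := hreal
    refine ⟨(E, false), by simp [step], ?_⟩
    simp only [Realizes, flipIf]
    refine ⟨hQ, ?_⟩
    rw [key, hP0, mul_zero, mul_zero, sub_zero]

/-! ### Soundness of the run along a design -/

variable (d : ℕ → ℕ) (f : ℕ → ℕ)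

/-- **the run is sound**: if `w` marks exactly the recessive edges at `x`, the pair `(D_n, D_{n+1})(x)` realises some branch of `runN w n`.
[this file] -/
theorem runN_sound {x : ℝ} (hx : 0 < x) (w : ℕ → Bool) (n : ℕ)
    (hw : ∀ k, k < n → if w k then x ^ (2 * f k) < x ^ (d k + d (k + 1)) else x ^ (d k + d (k + 1)) < x ^ (2 * f k)) :
    ∃ p ∈ runN w n, Realizes x (d n) ((pathDet (fun _ => (1 : ℝ)) d (fun _ => (1 : ℝ)) f n).eval x)
      ((pathDet (fun _ => (1 : ℝ)) d (fun _ => (1 : ℝ)) f (n + 1)).eval x) p.1 (sgn p.2) := by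
  induction n with
  | zero =>
    obtain ⟨e0, e1⟩ := eval_unit_zero_one d f x
    refine ⟨(E, false), by simp [runN], ?_⟩
    simp only [Realizes, sgn, e0, e1]
    norm_num
  | succ n ih =>
    obtain ⟨p, hp, hreal⟩ := ih (fun k hk => hw k (Nat.lt_succ_of_lt hk))
    have hσ : sgn p.2 = 1 ∨ sgn p.2 = -1 := by cases p.2 <;> simp [sgn]
    obtain ⟨q, hq, hq'⟩ := step_sound hx hσ (w n) hreal (d' := d (n + 1)) (f := f n) (hw n (Nat.lt_succ_self n))
    refine ⟨(q.1, xor p.2 q.2), ?_, ?_⟩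
    · simp only [runN, List.mem_flatMap, List.mem_map]
      exact ⟨p, hp, q, hq, rfl⟩
    · rw [show n + 1 + 1 = n + 2 from rfl, eval_unit_add_two]
      have hs : sgn (xor p.2 q.2) = flipIf q.2 (sgn p.2) := by
        rw [sgn_xor]; cases q.2 <;> simp [sgn, flipIf]
      rw [hs]
      exact hq'

/-- **emptiness at a point**: if the run ends without `Z`, the continuant `D_{n+1}` does not vanish at `x`. [this file] -/
theorem eval_ne_zero_of_noZero {x : ℝ} (hx : 0 < x) (w : ℕ → Bool) (n : ℕ)
    (hw : ∀ k, k < n → if w k then x ^ (2 * f k) < x ^ (d k + d (k + 1)) else x ^ (d k + d (k + 1)) < x ^ (2 * f k))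
    (hz : noZero w n = true) :
    (pathDet (fun _ => (1 : ℝ)) d (fun _ => (1 : ℝ)) f (n + 1)).eval x ≠ 0 := by
  obtain ⟨p, hp, hreal⟩ := runN_sound d f hx w n hw
  have hpZ : p.1 ≠ Z := by
    have := List.all_eq_true.1 hz p hp
    simpa using this
  exact ne_zero_of_realizes hreal hpZ hx

/-! ### The criterion for a slope-sign word -/

/-- **SIGN-AUTOMATON EMPTINESS CRITERION (all sizes).**  Let `asc k` record the slope signs of a unit design of size `n+1` (`true`: `L_k > 0`,
`false`: `L_k < 0`).  If the automaton run with `asc` (side `(0,1)`) and the run with `¬asc` (side `(1,∞)`) both avoid the zero state, and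
`(n+1) % 3 ≠ 2`, the design has NO positive determinant zero. [this file] -/
theorem card_posRoots_unit_eq_zero_of_automaton (n : ℕ) (asc : ℕ → Bool)
    (hasc : ∀ k, k < n → (asc k = true → d k + d (k + 1) < 2 * f k) ∧ (asc k = false → 2 * f k < d k + d (k + 1)))
    (h0 : noZero asc n = true) (h1 : noZero (fun k => !asc k) n = true) (hm : (n + 1) % 3 ≠ 2) :
    ((pathDet (fun _ => (1 : ℝ)) d (fun _ => (1 : ℝ)) f (n + 1)).roots.toFinset.filter (fun x => 0 < x)).card = 0 := by
  rw [Finset.card_eq_zero, Finset.eq_empty_iff_forall_notMem]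
  intro x hx
  simp only [Finset.mem_filter, Multiset.mem_toFinset, mem_roots', IsRoot.def] at hx
  obtain ⟨⟨-, hr⟩, hx0⟩ := hx
  rcases lt_trichotomy x 1 with hlt | heq | hgt
  · refine eval_ne_zero_of_noZero d f hx0 asc n (fun k hk => ?_) h0 hr
    obtain ⟨ha, hd⟩ := hasc k hk
    cases hk' : asc k
    · simp only [Bool.false_eq_true, ite_false]; exact pow_lt_pow_right_of_lt_one₀ hx0 hlt (hd hk')
    · simp only [ite_true]; exact pow_lt_pow_right_of_lt_one₀ hx0 hlt (ha hk')
  · subst heq; exact (isRoot_one_unit_iff d f (n + 1)).not.2 hm hr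
  · refine eval_ne_zero_of_noZero d f hx0 (fun k => !asc k) n (fun k hk => ?_) h1 hr
    obtain ⟨ha, hd⟩ := hasc k hk
    cases hk' : asc k
    · simp only [Bool.not_false, ite_true]; exact pow_lt_pow_right₀ hgt (hd hk')
    · simp only [Bool.not_true, Bool.false_eq_true, ite_false]; exact pow_lt_pow_right₀ hgt (ha hk')

/-- **SIGN-AUTOMATON EXACTLY-ONE CRITERION (sizes `≡ 2 mod 3`).**  Under the same two automaton checks, a design of size `n+1 ≡ 2 (mod 3)` has
EXACTLY ONE positive determinant zero, the resonance `x = 1`. [this file] -/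
theorem card_posRoots_unit_eq_one_of_automaton (n : ℕ) (asc : ℕ → Bool)
    (hasc : ∀ k, k < n → (asc k = true → d k + d (k + 1) < 2 * f k) ∧ (asc k = false → 2 * f k < d k + d (k + 1)))
    (h0 : noZero asc n = true) (h1 : noZero (fun k => !asc k) n = true) (hm : (n + 1) % 3 = 2) :
    ((pathDet (fun _ => (1 : ℝ)) d (fun _ => (1 : ℝ)) f (n + 1)).roots.toFinset.filter (fun x => 0 < x)).card = 1 := by
  set P := pathDet (fun _ => (1 : ℝ)) d (fun _ => (1 : ℝ)) f (n + 1) with hP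
  have hne : ∀ x : ℝ, 0 < x → x ≠ 1 → P.eval x ≠ 0 := by
    intro x hx0 hx1
    rcases lt_or_gt_of_ne hx1 with hlt | hgt
    · refine eval_ne_zero_of_noZero d f hx0 asc n (fun k hk => ?_) h0
      obtain ⟨ha, hd⟩ := hasc k hk
      cases hk' : asc k
      · simp only [Bool.false_eq_true, ite_false]; exact pow_lt_pow_right_of_lt_one₀ hx0 hlt (hd hk')
      · simp only [ite_true]; exact pow_lt_pow_right_of_lt_one₀ hx0 hlt (ha hk')
    · refine eval_ne_zero_of_noZero d f hx0 (fun k => !asc k) n (fun k hk => ?_) h1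
      obtain ⟨ha, hd⟩ := hasc k hk
      cases hk' : asc k
      · simp only [Bool.not_false, ite_true]; exact pow_lt_pow_right₀ hgt (hd hk')
      · simp only [Bool.not_true, Bool.false_eq_true, ite_false]; exact pow_lt_pow_right₀ hgt (ha hk')
  have hP0 : P ≠ 0 := fun h => hne 2 (by norm_num) (by norm_num) (by rw [h, eval_zero])
  have h1mem : (1 : ℝ) ∈ P.roots.toFinset.filter (fun x => 0 < x) := by
    simp only [Finset.mem_filter, Multiset.mem_toFinset, mem_roots']
    exact ⟨⟨hP0, (isRoot_one_unit_iff d f (n + 1)).2 hm⟩, one_pos⟩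
  refine le_antisymm (Finset.card_le_one.2 fun x hx y hy => ?_) (Finset.card_pos.2 ⟨1, h1mem⟩)
  have key : ∀ z, z ∈ P.roots.toFinset.filter (fun x => 0 < x) → z = 1 := by
    intro z hz
    simp only [Finset.mem_filter, Multiset.mem_toFinset, mem_roots', IsRoot.def] at hz
    by_contra hz1
    exact hne z hz.2 hz1 hz.1.2
  rw [key x hx, key y hy]

/-! ### Instances (located census = automaton output): empty classes of sizes 7 and 10, exactly-one classes of sizes 5 and 8 -/

/-- size 7, slope signs `+ + − + + −`: no positive zero. [this file] -/
theorem card_posRoots_unit_seven_ppmppm (h0 : d 0 + d 1 < 2 * f 0) (h1 : d 1 + d 2 < 2 * f 1) (h2 : 2 * f 2 < d 2 + d 3)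
    (h3 : d 3 + d 4 < 2 * f 3) (h4 : d 4 + d 5 < 2 * f 4) (h5 : 2 * f 5 < d 5 + d 6) :
    ((pathDet (fun _ => (1 : ℝ)) d (fun _ => (1 : ℝ)) f 7).roots.toFinset.filter (fun x => 0 < x)).card = 0 := by
  refine card_posRoots_unit_eq_zero_of_automaton d f 6 (wordOf [true, true, false, true, true, false]) (fun k hk => ?_)
    (by decide) (by decide) (by norm_num)
  interval_cases k <;> simp [wordOf] <;> omega

/-- size 7, slope signs `+ + − + − −`: no positive zero. [this file] -/
theorem card_posRoots_unit_seven_ppmpmm (h0 : d 0 + d 1 < 2 * f 0) (h1 : d 1 + d 2 < 2 * f 1) (h2 : 2 * f 2 < d 2 + d 3)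
    (h3 : d 3 + d 4 < 2 * f 3) (h4 : 2 * f 4 < d 4 + d 5) (h5 : 2 * f 5 < d 5 + d 6) :
    ((pathDet (fun _ => (1 : ℝ)) d (fun _ => (1 : ℝ)) f 7).roots.toFinset.filter (fun x => 0 < x)).card = 0 := by
  refine card_posRoots_unit_eq_zero_of_automaton d f 6 (wordOf [true, true, false, true, false, false]) (fun k hk => ?_)
    (by decide) (by decide) (by norm_num)
  interval_cases k <;> simp [wordOf] <;> omega

/-- size 7, slope signs `+ − − + + −`: no positive zero. [this file] -/
theorem card_posRoots_unit_seven_pmmppm (h0 : d 0 + d 1 < 2 * f 0) (h1 : 2 * f 1 < d 1 + d 2) (h2 : 2 * f 2 < d 2 + d 3)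
    (h3 : d 3 + d 4 < 2 * f 3) (h4 : d 4 + d 5 < 2 * f 4) (h5 : 2 * f 5 < d 5 + d 6) :
    ((pathDet (fun _ => (1 : ℝ)) d (fun _ => (1 : ℝ)) f 7).roots.toFinset.filter (fun x => 0 < x)).card = 0 := by
  refine card_posRoots_unit_eq_zero_of_automaton d f 6 (wordOf [true, false, false, true, true, false]) (fun k hk => ?_)
    (by decide) (by decide) (by norm_num)
  interval_cases k <;> simp [wordOf] <;> omega

/-- size 8, slope signs `+ + − + + − +`: exactly one positive zero (`x = 1`). [this file] -/
theorem card_posRoots_unit_eight_ppmppmp (h0 : d 0 + d 1 < 2 * f 0) (h1 : d 1 + d 2 < 2 * f 1) (h2 : 2 * f 2 < d 2 + d 3)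
    (h3 : d 3 + d 4 < 2 * f 3) (h4 : d 4 + d 5 < 2 * f 4) (h5 : 2 * f 5 < d 5 + d 6) (h6 : d 6 + d 7 < 2 * f 6) :
    ((pathDet (fun _ => (1 : ℝ)) d (fun _ => (1 : ℝ)) f 8).roots.toFinset.filter (fun x => 0 < x)).card = 1 := by
  refine card_posRoots_unit_eq_one_of_automaton d f 7 (wordOf [true, true, false, true, true, false, true]) (fun k hk => ?_)
    (by decide) (by decide) (by norm_num)
  interval_cases k <;> simp [wordOf] <;> omega

/-- size 5, slope signs `+ + − +`: exactly one positive zero (`x = 1`). [this file] -/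
theorem card_posRoots_unit_five_ppmp (h0 : d 0 + d 1 < 2 * f 0) (h1 : d 1 + d 2 < 2 * f 1) (h2 : 2 * f 2 < d 2 + d 3) (h3 : d 3 + d 4 < 2 * f 3) :
    ((pathDet (fun _ => (1 : ℝ)) d (fun _ => (1 : ℝ)) f 5).roots.toFinset.filter (fun x => 0 < x)).card = 1 := by
  refine card_posRoots_unit_eq_one_of_automaton d f 4 (wordOf [true, true, false, true]) (fun k hk => ?_)
    (by decide) (by decide) (by norm_num)
  interval_cases k <;> simp [wordOf] <;> omega

/-- size 5, slope signs `+ − − +`: exactly one positive zero (`x = 1`). [this file] -/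
theorem card_posRoots_unit_five_pmmp (h0 : d 0 + d 1 < 2 * f 0) (h1 : 2 * f 1 < d 1 + d 2) (h2 : 2 * f 2 < d 2 + d 3) (h3 : d 3 + d 4 < 2 * f 3) :
    ((pathDet (fun _ => (1 : ℝ)) d (fun _ => (1 : ℝ)) f 5).roots.toFinset.filter (fun x => 0 < x)).card = 1 := by
  refine card_posRoots_unit_eq_one_of_automaton d f 4 (wordOf [true, false, false, true]) (fun k hk => ?_)
    (by decide) (by decide) (by norm_num)
  interval_cases k <;> simp [wordOf] <;> omega

/-- size 8, slope signs `+ + − + − − +`: exactly one positive zero (`x = 1`). [this file] -/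
theorem card_posRoots_unit_eight_ppmpmmp (h0 : d 0 + d 1 < 2 * f 0) (h1 : d 1 + d 2 < 2 * f 1) (h2 : 2 * f 2 < d 2 + d 3) (h3 : d 3 + d 4 < 2 * f 3) (h4 : 2 * f 4 < d 4 + d 5) (h5 : 2 * f 5 < d 5 + d 6) (h6 : d 6 + d 7 < 2 * f 6) :
    ((pathDet (fun _ => (1 : ℝ)) d (fun _ => (1 : ℝ)) f 8).roots.toFinset.filter (fun x => 0 < x)).card = 1 := by
  refine card_posRoots_unit_eq_one_of_automaton d f 7 (wordOf [true, true, false, true, false, false, true]) (fun k hk => ?_)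
    (by decide) (by decide) (by norm_num)
  interval_cases k <;> simp [wordOf] <;> omega

/-- size 8, slope signs `+ − + + − − +`: exactly one positive zero (`x = 1`). [this file] -/
theorem card_posRoots_unit_eight_pmppmmp (h0 : d 0 + d 1 < 2 * f 0) (h1 : 2 * f 1 < d 1 + d 2) (h2 : d 2 + d 3 < 2 * f 2) (h3 : d 3 + d 4 < 2 * f 3) (h4 : 2 * f 4 < d 4 + d 5) (h5 : 2 * f 5 < d 5 + d 6) (h6 : d 6 + d 7 < 2 * f 6) :
    ((pathDet (fun _ => (1 : ℝ)) d (fun _ => (1 : ℝ)) f 8).roots.toFinset.filter (fun x => 0 < x)).card = 1 := by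
  refine card_posRoots_unit_eq_one_of_automaton d f 7 (wordOf [true, false, true, true, false, false, true]) (fun k hk => ?_)
    (by decide) (by decide) (by norm_num)
  interval_cases k <;> simp [wordOf] <;> omega

/-- size 8, slope signs `+ − − + − − +`: exactly one positive zero (`x = 1`). [this file] -/
theorem card_posRoots_unit_eight_pmmpmmp (h0 : d 0 + d 1 < 2 * f 0) (h1 : 2 * f 1 < d 1 + d 2) (h2 : 2 * f 2 < d 2 + d 3) (h3 : d 3 + d 4 < 2 * f 3) (h4 : 2 * f 4 < d 4 + d 5) (h5 : 2 * f 5 < d 5 + d 6) (h6 : d 6 + d 7 < 2 * f 6) :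
    ((pathDet (fun _ => (1 : ℝ)) d (fun _ => (1 : ℝ)) f 8).roots.toFinset.filter (fun x => 0 < x)).card = 1 := by
  refine card_posRoots_unit_eq_one_of_automaton d f 7 (wordOf [true, false, false, true, false, false, true]) (fun k hk => ?_)
    (by decide) (by decide) (by norm_num)
  interval_cases k <;> simp [wordOf] <;> omega

/-- size 10, slope signs `+ + − + + − + + −`: no positive zero. [this file] -/
theorem card_posRoots_unit_ten_ppmppmppm (h0 : d 0 + d 1 < 2 * f 0) (h1 : d 1 + d 2 < 2 * f 1) (h2 : 2 * f 2 < d 2 + d 3) (h3 : d 3 + d 4 < 2 * f 3) (h4 : d 4 + d 5 < 2 * f 4) (h5 : 2 * f 5 < d 5 + d 6) (h6 : d 6 + d 7 < 2 * f 6) (h7 : d 7 + d 8 < 2 * f 7) (h8 : 2 * f 8 < d 8 + d 9) :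
    ((pathDet (fun _ => (1 : ℝ)) d (fun _ => (1 : ℝ)) f 10).roots.toFinset.filter (fun x => 0 < x)).card = 0 := by
  refine card_posRoots_unit_eq_zero_of_automaton d f 9 (wordOf [true, true, false, true, true, false, true, true, false]) (fun k hk => ?_)
    (by decide) (by decide) (by norm_num)
  interval_cases k <;> simp [wordOf] <;> omega

/-- size 10, slope signs `+ + − + + − + − −`: no positive zero. [this file] -/
theorem card_posRoots_unit_ten_ppmppmpmm (h0 : d 0 + d 1 < 2 * f 0) (h1 : d 1 + d 2 < 2 * f 1) (h2 : 2 * f 2 < d 2 + d 3) (h3 : d 3 + d 4 < 2 * f 3) (h4 : d 4 + d 5 < 2 * f 4) (h5 : 2 * f 5 < d 5 + d 6) (h6 : d 6 + d 7 < 2 * f 6) (h7 : 2 * f 7 < d 7 + d 8) (h8 : 2 * f 8 < d 8 + d 9) :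
    ((pathDet (fun _ => (1 : ℝ)) d (fun _ => (1 : ℝ)) f 10).roots.toFinset.filter (fun x => 0 < x)).card = 0 := by
  refine card_posRoots_unit_eq_zero_of_automaton d f 9 (wordOf [true, true, false, true, true, false, true, false, false]) (fun k hk => ?_)
    (by decide) (by decide) (by norm_num)
  interval_cases k <;> simp [wordOf] <;> omega

/-- size 10, slope signs `+ + − + − − + + −`: no positive zero. [this file] -/
theorem card_posRoots_unit_ten_ppmpmmppm (h0 : d 0 + d 1 < 2 * f 0) (h1 : d 1 + d 2 < 2 * f 1) (h2 : 2 * f 2 < d 2 + d 3) (h3 : d 3 + d 4 < 2 * f 3) (h4 : 2 * f 4 < d 4 + d 5) (h5 : 2 * f 5 < d 5 + d 6) (h6 : d 6 + d 7 < 2 * f 6) (h7 : d 7 + d 8 < 2 * f 7) (h8 : 2 * f 8 < d 8 + d 9) :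
    ((pathDet (fun _ => (1 : ℝ)) d (fun _ => (1 : ℝ)) f 10).roots.toFinset.filter (fun x => 0 < x)).card = 0 := by
  refine card_posRoots_unit_eq_zero_of_automaton d f 9 (wordOf [true, true, false, true, false, false, true, true, false]) (fun k hk => ?_)
    (by decide) (by decide) (by norm_num)
  interval_cases k <;> simp [wordOf] <;> omega

/-- size 10, slope signs `+ − − + + − + + −`: no positive zero. [this file] -/
theorem card_posRoots_unit_ten_pmmppmppm (h0 : d 0 + d 1 < 2 * f 0) (h1 : 2 * f 1 < d 1 + d 2) (h2 : 2 * f 2 < d 2 + d 3) (h3 : d 3 + d 4 < 2 * f 3) (h4 : d 4 + d 5 < 2 * f 4) (h5 : 2 * f 5 < d 5 + d 6) (h6 : d 6 + d 7 < 2 * f 6) (h7 : d 7 + d 8 < 2 * f 7) (h8 : 2 * f 8 < d 8 + d 9) :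
    ((pathDet (fun _ => (1 : ℝ)) d (fun _ => (1 : ℝ)) f 10).roots.toFinset.filter (fun x => 0 < x)).card = 0 := by
  refine card_posRoots_unit_eq_zero_of_automaton d f 9 (wordOf [true, false, false, true, true, false, true, true, false]) (fun k hk => ?_)
    (by decide) (by decide) (by norm_num)
  interval_cases k <;> simp [wordOf] <;> omega

end StaticTridiagonalRealUnit
end Summit.ValiantsHypothesis.ValiantsHypothesis.Theorems.KPlusLogSqLaw
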